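import Literature.NumberTheory.LFunctions.SuzukiSingleOperatorKernelProofs
import Literature.NumberTheory.LFunctions.SuzukiSmallWindows

/-!
# SuzukiHSWindow — the Hilbert–Schmidt clean-window test for truncated Hankel-type operators `𝖪[t]` (column DBR; RH-FREE, K-general)

RH-FREE and `ζ`-free throughout; nothing here bears on the truth of RH (a clean window certifies nothing about RH).

For a continuous kernel `K : ℝ → ℝ` the window operator `f ↦ ∫_{(−t,t)} K(· + y) f(y) dy` on `L²(−t,t)` has
Hilbert–Schmidt norm `‖𝖪[t]‖²_HS = ∫_{(−t,t)} ∫_{(−t,t)} K(x+y)² dy dx`, and `‖𝖪[t]‖_op ≤ ‖𝖪[t]‖_HS`.  Hence: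

* §1 `sq_setIntegral_mul_le` — Cauchy–Schwarz on the window: `(∫ K(x+y) f(y) dy)² ≤ (∫ K(x+y)² dy)·(∫ f²)`;
* §2 **`noUnitEigenvalue_of_sq_integral_lt_one`** — if `∫∫_{(−t,t)²} K(x+y)² < 1` then `±1` is not an eigenvalue of
  `𝖪[t]` (`NoUnitEigenvalue K t`, the tree's window predicate): an eigenfunction has `f(x)² ≤ ‖𝖪‖²… `, integrate, `‖f‖² ≤
  HS²·‖f‖²`, so `f = 0` a.e.  This is the `L²` companion of the tree's sup-norm test `noUnitEigenvalue_of_small_window`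
  ([Su21] Prop. 4.2 mechanism) and is the test behind the cell rh-dbr's certified DATA rung ET1 (Hilbert–Schmidt clean radii
  `t_HS(12) = 0.8268…`, `t_HS(20) = 1.2384…` of Suzuki's `K_θ`, two interval lineages, 2026-08-26): by this theorem every
  certified instance `HS²(t) < 1` is an unconditional clean window;
* §3 one-sided kernels (`K = 0` on `(−∞,0)`, e.g. `K_θ` by [Su20] Thm 1.2 (K-iii)): the crude one-variable bound
  `∫∫_{(−t,t)²} K(x+y)² ≤ 2t ∫_{(0,2t)} K²` (`sq_integral_window_le_of_vanishing`; the exact value is `∫_0^{2t}(2t−u)K(u)² du`,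
  not needed here) and the resulting tests for `K_θ = limKernel θ`, `θ > 1`.

References: [Su20] M. Suzuki, ASPM 84 (2020) 399–411 = arXiv:1907.07302, Thm 1.2; [Su21] M. Suzuki, J. Funct. Anal. 281 (2021)
109116 = arXiv:1606.05726, Prop. 4.2 and §3.4 (Hilbert–Schmidt / Fredholm-determinant control of `𝖪[t]`).
-/

noncomputable section

-- D-0017: `Summit.<S>.<S>.…` is the designed namespace of a single-problem summit.
set_option linter.dupNamespace false

open MeasureTheory Set Filter Topology

namespace Summit.RiemannHypothesis.RiemannHypothesis.Theorems.SuzukiHSWindow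

open Literature.NumberTheory.LFunctions

/-! ## §1 Cauchy–Schwarz on the window -/

/-- A continuous kernel row `y ↦ K(x + y)` is in `L²` of the window measure (bounded on a set of finite measure). -/
theorem memLp_two_kernel_row {K : ℝ → ℝ} (hK : Continuous K) (t x : ℝ) :
    MemLp (fun y : ℝ => K (x + y)) 2 (volume.restrict (Ioo (-t) t)) := by
  have hKc : Continuous fun y : ℝ => K (x + y) := hK.comp (continuous_const.add continuous_id)
  obtain ⟨C, hC⟩ :=
    (isCompact_Icc : IsCompact (Icc (-t) t)).exists_bound_of_continuousOn hKc.continuousOn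
  refine MemLp.of_bound hKc.aestronglyMeasurable C ?_
  filter_upwards [ae_restrict_mem measurableSet_Ioo] with y hy
  exact hC y (Ioo_subset_Icc_self hy)

/-- **Cauchy–Schwarz on the window**: for continuous `K`, `f ∈ L²(−t,t)` and every `x`,
`(∫_{(−t,t)} K(x+y) f(y) dy)² ≤ (∫_{(−t,t)} K(x+y)² dy) · ∫_{(−t,t)} f²`. -/
theorem sq_setIntegral_mul_le {K : ℝ → ℝ} (hK : Continuous K) {t : ℝ} {f : ℝ → ℝ}
    (hf : MemLp f 2 (volume.restrict (Ioo (-t) t))) (x : ℝ) :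
    (∫ y in Ioo (-t) t, K (x + y) * f y) ^ 2 ≤
      (∫ y in Ioo (-t) t, K (x + y) ^ 2) * ∫ y in Ioo (-t) t, f y ^ 2 := by
  set μ := volume.restrict (Ioo (-t) t) with hμ
  have hKmem := memLp_two_kernel_row hK t x
  have h := integral_mul_norm_le_Lp_mul_Lq (μ := μ) (f := fun y : ℝ => K (x + y)) (g := f)
    Real.HolderConjugate.two_two (by simpa using hKmem) (by simpa using hf)
  simp only [Real.norm_eq_abs, Real.rpow_two, sq_abs] at h
  set A : ℝ := ∫ y, K (x + y) ^ 2 ∂μ with hA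
  set B : ℝ := ∫ y, f y ^ 2 ∂μ with hB
  have hA0 : 0 ≤ A := integral_nonneg fun _ => sq_nonneg _
  have hB0 : 0 ≤ B := integral_nonneg fun _ => sq_nonneg _
  -- `|∫ K f| ≤ ∫ |K| |f|`
  have h1 : |∫ y, K (x + y) * f y ∂μ| ≤ ∫ y, |K (x + y)| * |f y| ∂μ := by
    have := norm_integral_le_integral_norm (μ := μ) (fun y : ℝ => K (x + y) * f y)
    simpa [Real.norm_eq_abs, abs_mul] using this
  have h2 : |∫ y, K (x + y) * f y ∂μ| ≤ A ^ (1 / 2 : ℝ) * B ^ (1 / 2 : ℝ) := h1.trans h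
  have h3 : 0 ≤ A ^ (1 / 2 : ℝ) * B ^ (1 / 2 : ℝ) := by positivity
  have h4 : (∫ y, K (x + y) * f y ∂μ) ^ 2 ≤ (A ^ (1 / 2 : ℝ) * B ^ (1 / 2 : ℝ)) ^ 2 := by
    rw [← sq_abs (∫ y, K (x + y) * f y ∂μ)]
    exact pow_le_pow_left₀ (abs_nonneg _) h2 2
  have h5 : (A ^ (1 / 2 : ℝ) * B ^ (1 / 2 : ℝ)) ^ 2 = A * B := by
    rw [mul_pow, ← Real.rpow_natCast (A ^ (1 / 2 : ℝ)), ← Real.rpow_natCast (B ^ (1 / 2 : ℝ)),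
      ← Real.rpow_mul hA0, ← Real.rpow_mul hB0]
    norm_num
  rw [h5] at h4
  exact h4

/-! ## §2 The Hilbert–Schmidt test -/

/-- The row energy `x ↦ ∫_{(−t,t)} K(x+y)² dy` is continuous (continuous integrand on a compact window). -/
theorem continuous_rowEnergy {K : ℝ → ℝ} (hK : Continuous K) (t : ℝ) :
    Continuous fun x : ℝ => ∫ y in Ioo (-t) t, K (x + y) ^ 2 := by
  have h1 : Continuous fun x : ℝ => ∫ y in Icc (-t) t, K (x + y) ^ 2 :=
    continuous_parametric_integral_of_continuous
      (by fun_prop : Continuous (Function.uncurry fun (x y : ℝ) => K (x + y) ^ 2)) isCompact_Icc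
  have h2 : (fun x : ℝ => ∫ y in Ioo (-t) t, K (x + y) ^ 2) = fun x : ℝ => ∫ y in Icc (-t) t, K (x + y) ^ 2 := by
    funext x; exact setIntegral_congr_set Ioo_ae_eq_Icc
  rw [h2]; exact h1

/-- **HILBERT–SCHMIDT CLEAN-WINDOW TEST** (RH-FREE, `ζ`-free, K-general): if `K` is continuous and
`∫_{(−t,t)} ∫_{(−t,t)} K(x+y)² dy dx < 1` (the squared Hilbert–Schmidt norm of `𝖪[t]`), then `±1` is not an eigenvalue
of `f ↦ ∫_{(−t,t)} K(· + y) f(y) dy` on `L²(−t,t)` (`NoUnitEigenvalue K t`).  Proof: an eigenfunction satisfies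
`f(x)² ≤ (∫ K(x+y)² dy) ‖f‖²` a.e. (§1); integrating, `‖f‖² ≤ HS² ‖f‖²`, so `‖f‖ = 0`. -/
theorem noUnitEigenvalue_of_sq_integral_lt_one {K : ℝ → ℝ} (hK : Continuous K) {t : ℝ}
    (hHS : ∫ x in Ioo (-t) t, ∫ y in Ioo (-t) t, K (x + y) ^ 2 < 1) : NoUnitEigenvalue K t := by
  intro ε hε f hf heig
  rcases le_or_gt t 0 with ht | ht
  · -- the window `(−t,t)` is empty
    have he : Ioo (-t) t = ∅ := Ioo_eq_empty (by linarith)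
    rw [Filter.EventuallyEq, ae_iff, he, Measure.restrict_empty]
    rfl
  · set μ := volume.restrict (Ioo (-t) t) with hμ
    set N : ℝ := ∫ y in Ioo (-t) t, f y ^ 2 with hN
    set H : ℝ → ℝ := fun x => ∫ y in Ioo (-t) t, K (x + y) ^ 2 with hH
    have hN0 : 0 ≤ N := integral_nonneg fun _ => sq_nonneg _
    have hHc : Continuous H := continuous_rowEnergy hK t
    have hf2 : Integrable (fun y => f y ^ 2) μ := hf.integrable_sq
    -- pointwise a.e.: `f(x)² ≤ N · H(x)`
    have hpt : ∀ᵐ x ∂μ, f x ^ 2 ≤ N * H x := by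
      filter_upwards [heig] with x hx
      have h1 : f x ^ 2 = (∫ y in Ioo (-t) t, K (x + y) * f y) ^ 2 := by
        rw [hx, mul_pow]
        rcases hε with rfl | rfl <;> norm_num
      rw [h1]
      have := sq_setIntegral_mul_le hK hf x
      rw [mul_comm] at this
      exact this
    -- integrate over the window
    have hHi : Integrable (fun x => N * H x) μ :=
      ((hHc.integrableOn_Icc (a := -t) (b := t)).mono_set Ioo_subset_Icc_self).const_mul N
    have hle : N ≤ N * ∫ x in Ioo (-t) t, H x := by
      have := integral_mono_ae hf2 hHi hpt
      rwa [integral_const_mul] at this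
    have hS : ∫ x in Ioo (-t) t, H x < 1 := hHS
    have hNz : N = 0 := by
      refine le_antisymm ?_ hN0
      nlinarith
    have hae : (fun y => f y ^ 2) =ᵐ[μ] 0 :=
      (integral_eq_zero_iff_of_nonneg_ae (Eventually.of_forall fun y => sq_nonneg (f y)) hf2).1 hNz
    filter_upwards [hae] with y hy
    simpa using hy

/-! ## §3 One-sided kernels: a one-variable bound, and the tests for `K_θ` -/

/-- Translation of the window: `∫_{(−t,t)} g(x+y) dy = ∫_{(x−t, x+t)} g(v) dv` (`t > 0`). -/
theorem setIntegral_comp_add_window (g : ℝ → ℝ) {t : ℝ} (ht : 0 < t) (x : ℝ) :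
    ∫ y in Ioo (-t) t, g (x + y) = ∫ v in Ioo (x - t) (x + t), g v := by
  have h1 : ∫ y in Ioo (-t) t, g (x + y) = ∫ y in (-t)..t, g (x + y) := by
    rw [intervalIntegral.integral_of_le (by linarith), integral_Ioc_eq_integral_Ioo]
  have h2 : ∫ v in Ioo (x - t) (x + t), g v = ∫ v in (x - t)..(x + t), g v := by
    rw [intervalIntegral.integral_of_le (by linarith), integral_Ioc_eq_integral_Ioo]
  rw [h1, h2, intervalIntegral.integral_comp_add_left (fun v => g v) x]
  congr 1

/-- **One-variable bound for one-sided kernels**: if `K` is continuous with `K = 0` on `(−∞,0)` and `t > 0`, then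
`∫_{(−t,t)} ∫_{(−t,t)} K(x+y)² dy dx ≤ 2t · ∫_{(0,2t)} K²` (each row `∫_{(x−t,x+t)} K² ≤ ∫_{(−2t,2t)} K² = ∫_{(0,2t)} K²`). -/
theorem sq_integral_window_le_of_vanishing {K : ℝ → ℝ} (hK : Continuous K) (h0 : ∀ u : ℝ, u < 0 → K u = 0)
    {t : ℝ} (ht : 0 < t) :
    ∫ x in Ioo (-t) t, ∫ y in Ioo (-t) t, K (x + y) ^ 2 ≤ 2 * t * ∫ u in Ioo 0 (2 * t), K u ^ 2 := by
  have hK2 : Continuous fun u : ℝ => K u ^ 2 := hK.pow 2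
  set S : ℝ := ∫ u in Ioo 0 (2 * t), K u ^ 2 with hS
  -- `∫_{(−2t,2t)} K² = ∫_{[0,2t)} K² = S`
  have hbig : ∫ u in Ioo (-(2 * t)) (2 * t), K u ^ 2 = S := by
    have h1 : ∫ u in Ioo (-(2 * t)) (2 * t), K u ^ 2 = ∫ u in Ico 0 (2 * t), K u ^ 2 := by
      refine setIntegral_eq_of_subset_of_forall_sdiff_eq_zero measurableSet_Ioo
        (fun u hu => ⟨by linarith [hu.1], hu.2⟩) fun u hu => ?_
      have hu0 : u < 0 := by
        by_contra hnn
        exact hu.2 ⟨not_lt.1 hnn, hu.1.2⟩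
      rw [h0 u hu0]; ring
    rw [h1, hS]
    exact setIntegral_congr_set Ioo_ae_eq_Ico.symm
  -- each row is at most `S`
  have hrow : ∀ x ∈ Ioo (-t) t, ∫ y in Ioo (-t) t, K (x + y) ^ 2 ≤ S := by
    intro x hx
    rw [setIntegral_comp_add_window (fun u => K u ^ 2) ht x, ← hbig]
    refine setIntegral_mono_set ((hK2.integrableOn_Icc (a := -(2 * t)) (b := 2 * t)).mono_set Ioo_subset_Icc_self)
      (Eventually.of_forall fun u => sq_nonneg (K u)) (Eventually.of_forall fun u hu => ?_)
    exact ⟨by linarith [hu.1, hx.1], by linarith [hu.2, hx.2]⟩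
  -- integrate the row bound over the window of length `2t`
  have hHi : IntegrableOn (fun x : ℝ => ∫ y in Ioo (-t) t, K (x + y) ^ 2) (Ioo (-t) t) :=
    ((continuous_rowEnergy hK t).integrableOn_Icc (a := -t) (b := t)).mono_set Ioo_subset_Icc_self
  calc ∫ x in Ioo (-t) t, ∫ y in Ioo (-t) t, K (x + y) ^ 2
      ≤ ∫ x in Ioo (-t) t, S := setIntegral_mono_on hHi (by
          exact (continuous_const.integrableOn_Icc (a := -t) (b := t)).mono_set Ioo_subset_Icc_self)
          measurableSet_Ioo hrow
    _ = 2 * t * S := by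
        rw [setIntegral_const, Real.volume_real_Ioo_of_le (by linarith), smul_eq_mul]; ring

/-- **One-variable clean-window test for one-sided kernels** (RH-FREE, K-general): `K` continuous, `K = 0` on `(−∞,0)`,
and `2t · ∫_{(0,2t)} K² < 1` imply `NoUnitEigenvalue K t`. -/
theorem noUnitEigenvalue_of_oneSided_sq_integral_lt_one {K : ℝ → ℝ} (hK : Continuous K)
    (h0 : ∀ u : ℝ, u < 0 → K u = 0) {t : ℝ} (h : 2 * t * ∫ u in Ioo 0 (2 * t), K u ^ 2 < 1) :
    NoUnitEigenvalue K t := by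
  rcases le_or_gt t 0 with ht | ht
  · intro ε hε f hf heig
    have he : Ioo (-t) t = ∅ := Ioo_eq_empty (by linarith)
    rw [Filter.EventuallyEq, ae_iff, he, Measure.restrict_empty]
    rfl
  · exact noUnitEigenvalue_of_sq_integral_lt_one hK ((sq_integral_window_le_of_vanishing hK h0 ht).trans_lt h)

/-- **The Hilbert–Schmidt test for Suzuki's `K_θ`** (RH-FREE; `θ > 1`): if `∫_{(−t,t)}∫_{(−t,t)} K_θ(x+y)² dy dx < 1`
(`= ∫_0^{2t} (2t − u) K_θ(u)² du`, the quantity certified by the cell's ET1 lineages), then `𝖪_θ[t]` has no eigenvalue `±1`.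
Continuity of `K_θ` is the tree theorem `Suzuki2020_thm12_continuous` ([Su20] Thm 1.2 (K-ii)). -/
theorem limKernel_noUnitEigenvalue_of_sq_integral_lt_one {θ : ℝ} (hθ : 1 < θ) {t : ℝ}
    (hHS : ∫ x in Ioo (-t) t, ∫ y in Ioo (-t) t, limKernel θ (x + y) ^ 2 < 1) :
    NoUnitEigenvalue (limKernel θ) t :=
  noUnitEigenvalue_of_sq_integral_lt_one (Suzuki2020_thm12_continuous hθ) hHS

/-- **One-variable test for `K_θ`** (RH-FREE; `θ > 1`): `2t · ∫_{(0,2t)} K_θ(u)² du < 1` implies that `𝖪_θ[t]` has no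
eigenvalue `±1` (`K_θ = 0` on `(−∞,0)` is the tree theorem `Suzuki2020_thm12_Kiii`, [Su20] Thm 1.2 (K-iii)). -/
theorem limKernel_noUnitEigenvalue_of_oneSided {θ : ℝ} (hθ : 1 < θ) {t : ℝ}
    (h : 2 * t * ∫ u in Ioo 0 (2 * t), limKernel θ u ^ 2 < 1) : NoUnitEigenvalue (limKernel θ) t :=
  noUnitEigenvalue_of_oneSided_sq_integral_lt_one (Suzuki2020_thm12_continuous hθ)
    (fun _ hu => Suzuki2020_thm12_Kiii hθ hu) h

/-! ## §4 One-sided kernels: the EXACT one-variable reduction `∫∫_{(−t,t)²} K(x+y)² = ∫₀^{2t} (2t − u) K(u)² du`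

This is the quantity `h(t)` certified by the cell's ET1 lineages (`t_HS(θ) = sup {t : h(t) < 1}`); with it, a certified
`h(t) < 1` is literally the hypothesis of `noUnitEigenvalue_of_weightedSq_lt_one` below.  Proof without Fubini:
with `G(v) = ∫₀^v K²` (so `G = 0` on `(−∞,0]`), each row is `G(x+t) − G(x−t)`, the rows integrate to `∫₀^{2t} G`,
and `∫₀^{2t} G = ∫₀^{2t} (2t − u) K(u)² du` by parts. -/

/-- A continuous kernel vanishing on `(−∞,0)` vanishes at `0`. -/
theorem apply_zero_eq_zero_of_vanishing {K : ℝ → ℝ} (hK : Continuous K) (h0 : ∀ u : ℝ, u < 0 → K u = 0) :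
    K 0 = 0 := by
  by_contra hne
  have hpos : 0 < |K 0| := abs_pos.2 hne
  obtain ⟨δ, hδ, hδK⟩ := Metric.continuous_iff.1 hK 0 (|K 0|) hpos
  have hd : dist (-(δ / 2)) (0 : ℝ) < δ := by
    rw [Real.dist_eq, sub_zero, abs_neg, abs_of_pos (half_pos hδ)]; linarith
  have h1 := hδK (-(δ / 2)) hd
  rw [h0 (-(δ / 2)) (by linarith), Real.dist_eq, zero_sub, abs_neg] at h1
  exact lt_irrefl _ h1

/-- For a one-sided continuous kernel, `K(u)² = 0` for every `u ≤ 0`. -/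
theorem sq_eq_zero_of_nonpos {K : ℝ → ℝ} (hK : Continuous K) (h0 : ∀ u : ℝ, u < 0 → K u = 0) {u : ℝ}
    (hu : u ≤ 0) : K u ^ 2 = 0 := by
  rcases hu.lt_or_eq with h | h
  · rw [h0 u h]; ring
  · rw [h, apply_zero_eq_zero_of_vanishing hK h0]; ring

/-- The primitive `G(v) = ∫₀^v K(u)² du` vanishes for `v ≤ 0` when `K` is one-sided. -/
theorem primitive_sq_eq_zero_of_nonpos {K : ℝ → ℝ} (hK : Continuous K) (h0 : ∀ u : ℝ, u < 0 → K u = 0) {v : ℝ}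
    (hv : v ≤ 0) : ∫ u in (0 : ℝ)..v, K u ^ 2 = 0 := by
  have h : ∫ u in (0 : ℝ)..v, K u ^ 2 = ∫ u in (0 : ℝ)..v, (0 : ℝ) := by
    refine intervalIntegral.integral_congr fun u hu => ?_
    have hu' : u ≤ 0 := by
      rw [uIcc_of_ge hv] at hu
      exact hu.2
    exact sq_eq_zero_of_nonpos hK h0 hu'
  rw [h, intervalIntegral.integral_zero]

/-- Row identity: `∫_{(−t,t)} K(x+y)² dy = G(x+t) − G(x−t)`, `G(v) = ∫₀^v K²` (`t > 0`, `K` continuous). -/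
theorem rowEnergy_eq_primitive_sub {K : ℝ → ℝ} (hK : Continuous K) {t : ℝ} (ht : 0 < t) (x : ℝ) :
    ∫ y in Ioo (-t) t, K (x + y) ^ 2 =
      (∫ u in (0 : ℝ)..(x + t), K u ^ 2) - ∫ u in (0 : ℝ)..(x - t), K u ^ 2 := by
  have hK2 : Continuous fun u : ℝ => K u ^ 2 := hK.pow 2
  rw [setIntegral_comp_add_window (fun u => K u ^ 2) ht x, ← integral_Ioc_eq_integral_Ioo,
    ← intervalIntegral.integral_of_le (by linarith),
    intervalIntegral.integral_interval_sub_left (hK2.intervalIntegrable _ _) (hK2.intervalIntegrable _ _)]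

/-- **EXACT ONE-VARIABLE REDUCTION** (RH-FREE, K-general): for `K` continuous with `K = 0` on `(−∞,0)` and `t > 0`,
`∫_{(−t,t)} ∫_{(−t,t)} K(x+y)² dy dx = ∫₀^{2t} (2t − u) K(u)² du`. -/
theorem sq_integral_window_eq_weighted {K : ℝ → ℝ} (hK : Continuous K) (h0 : ∀ u : ℝ, u < 0 → K u = 0)
    {t : ℝ} (ht : 0 < t) :
    ∫ x in Ioo (-t) t, ∫ y in Ioo (-t) t, K (x + y) ^ 2 = ∫ u in (0 : ℝ)..(2 * t), (2 * t - u) * K u ^ 2 := by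
  have hK2 : Continuous fun u : ℝ => K u ^ 2 := hK.pow 2
  set G : ℝ → ℝ := fun v => ∫ u in (0 : ℝ)..v, K u ^ 2 with hG
  have hGd : ∀ w : ℝ, HasDerivAt G (K w ^ 2) w := fun w => (hK2.integral_hasStrictDerivAt 0 w).hasDerivAt
  have hGdiff : Differentiable ℝ G := fun w => (hGd w).differentiableAt
  have hGc : Continuous G := hGdiff.continuous
  have hc1 : Continuous fun x : ℝ => G (x + t) := hGc.comp (continuous_id.add continuous_const)
  have hc2 : Continuous fun x : ℝ => G (x - t) := hGc.comp (continuous_id.sub continuous_const)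
  have hG0 : ∀ v : ℝ, v ≤ 0 → G v = 0 := fun v hv => primitive_sq_eq_zero_of_nonpos hK h0 hv
  -- rows
  have hrows : (fun x : ℝ => ∫ y in Ioo (-t) t, K (x + y) ^ 2) = fun x : ℝ => G (x + t) - G (x - t) := by
    funext x; exact rowEnergy_eq_primitive_sub hK ht x
  -- outer integral as an interval integral
  have hout : ∫ x in Ioo (-t) t, ∫ y in Ioo (-t) t, K (x + y) ^ 2 = ∫ x in (-t)..t, (G (x + t) - G (x - t)) := by
    rw [intervalIntegral.integral_of_le (by linarith), integral_Ioc_eq_integral_Ioo, hrows]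
  rw [hout, intervalIntegral.integral_sub (hc1.intervalIntegrable _ _) (hc2.intervalIntegrable _ _),
    intervalIntegral.integral_comp_add_right (fun v => G v) t,
    intervalIntegral.integral_comp_sub_right (fun v => G v) t]
  -- `∫_{−2t}^{0} G = 0`
  have hneg : ∫ v in (-t - t)..(t - t), G v = 0 := by
    have h : ∫ v in (-t - t)..(t - t), G v = ∫ v in (-t - t)..(t - t), (0 : ℝ) := by
      refine intervalIntegral.integral_congr fun v hv => ?_
      have hv' : v ≤ 0 := by
        rw [uIcc_of_le (by linarith)] at hv
        linarith [hv.2]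
      exact hG0 v hv'
    rw [h, intervalIntegral.integral_zero]
  rw [hneg, sub_zero, show -t + t = (0 : ℝ) by ring, show t + t = 2 * t by ring]
  -- integration by parts on `[0, 2t]`: `∫ (2t − u) K(u)² = [(2t−u) G(u)]₀^{2t} + ∫ G = ∫ G`
  have hparts := intervalIntegral.integral_mul_deriv_eq_deriv_mul (a := (0 : ℝ)) (b := 2 * t)
    (u := fun w : ℝ => 2 * t - w) (u' := fun _ : ℝ => (-1 : ℝ)) (v := G) (v' := fun w : ℝ => K w ^ 2)
    (fun w _ => by simpa using (hasDerivAt_id w).const_sub (2 * t)) (fun w _ => hGd w)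
    (continuous_const.intervalIntegrable _ _) (hK2.intervalIntegrable _ _)
  have hG00 : G 0 = 0 := hG0 0 le_rfl
  simp only [sub_self, zero_mul, hG00, mul_zero, sub_zero, zero_sub, neg_mul, one_mul,
    intervalIntegral.integral_neg, neg_neg] at hparts
  -- hparts : ∫ w in 0..2t, (2t − w) * K w ^ 2 = ∫ w in 0..2t, G w
  rw [hparts]

/-- **WEIGHTED ONE-VARIABLE CLEAN-WINDOW TEST** (RH-FREE, `ζ`-free, K-general): if `K` is continuous, `K = 0` on
`(−∞,0)`, and `h(t) := ∫₀^{2t} (2t − u) K(u)² du < 1`, then `±1` is not an eigenvalue of `𝖪[t]` on `L²(−t,t)`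
(`NoUnitEigenvalue K t`).  `h(t)` is exactly `‖𝖪[t]‖²_HS`; this is the statement a certified enclosure `h(t) < 1` feeds. -/
theorem noUnitEigenvalue_of_weightedSq_lt_one {K : ℝ → ℝ} (hK : Continuous K) (h0 : ∀ u : ℝ, u < 0 → K u = 0)
    {t : ℝ} (h : ∫ u in (0 : ℝ)..(2 * t), (2 * t - u) * K u ^ 2 < 1) : NoUnitEigenvalue K t := by
  rcases le_or_gt t 0 with ht | ht
  · intro ε hε f hf heig
    have he : Ioo (-t) t = ∅ := Ioo_eq_empty (by linarith)
    rw [Filter.EventuallyEq, ae_iff, he, Measure.restrict_empty]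
    rfl
  · refine noUnitEigenvalue_of_sq_integral_lt_one hK ?_
    rwa [sq_integral_window_eq_weighted hK h0 ht]

/-- **The weighted test for Suzuki's `K_θ`** (RH-FREE; `θ > 1`): `∫₀^{2t} (2t − u) K_θ(u)² du < 1` implies that
`𝖪_θ[t]` has no eigenvalue `±1` — the tree implication behind the cell's certified Hilbert–Schmidt radii
(DATA.md §ET1: the premise holds for `θ = 12`, all `t ≤ 0.8268…`, and `θ = 20`, all `t ≤ 1.2384…`; such instances are
unconditional finite facts, never evidence for RH).  Inputs: `Suzuki2020_thm12_continuous`, `Suzuki2020_thm12_Kiii`. -/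
theorem limKernel_noUnitEigenvalue_of_weightedSq_lt_one {θ : ℝ} (hθ : 1 < θ) {t : ℝ}
    (h : ∫ u in (0 : ℝ)..(2 * t), (2 * t - u) * limKernel θ u ^ 2 < 1) : NoUnitEigenvalue (limKernel θ) t :=
  noUnitEigenvalue_of_weightedSq_lt_one (Suzuki2020_thm12_continuous hθ) (fun _ hu => Suzuki2020_thm12_Kiii hθ hu) h

end Summit.RiemannHypothesis.RiemannHypothesis.Theorems.SuzukiHSWindow

end
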